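import Summits.AtomisticToContinuum.Crystallization.Theorems.OverbindingBudgetMisfitCensus

/-!
# OverbindingBudget — «MisfitRegistration»: SEG ⟸ TwoShellShape ∧ RegisteredScaleGap ∧ NearChargeGap (decomp-a2c lens-4, generation 38)

Helper file (`--supports stmt-AtomisticToContinuum-31280`); imports only the g37 node `…OverbindingBudgetMisfitCensus` (whose closure contains
`…OverbindingBudgetTwoShellShape`).  NODE g38 beneath the leaf of record SEG = `ScaleEnergyGap (122/125) 0` (critic row 556):

    ScaleEnergyGap a s  ⟸  TwoShellShape (1/100) ε g  ∧  RegisteredScaleGap a s ρ ε g  ∧  NearChargeGap (7ρ/2 + 5/2)      (ρ ≥ 0; seam PROVED, §E)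

* `TwoShellShape (1/100) ε g` — slot 3 of the cone of record, BY NAME: a charge-free site whose `5/2·nn`-neighbourhood is charge-free is
  two-shell FRAMED (a linear-isometric image of the fcc or hcp two-shell pattern within `ε·nn`, covering every site within `(3/2+g)·nn`).
* `RegisteredScaleGap a s ρ ε g` («RSG», piece α, crux) — the census SEG restricted to DEEPLY REGISTERED scale-bad sites (every site within
  `ρ·nn` charge-free and framed), with the rebate enlarged to ALL unregistered sites: the aggregate Cauchy–Born / geometric-rigidity coercivity
  of registered matter.  KERNEL-WEAKER than SEG (§C `registeredScaleGap_of_scaleEnergyGap`, PROVED: prices a subset, rebates a superset).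
* `NearChargeGap ρ'` («NCG», piece β′, crux) — `c` per charge-free site within `ρ'·nn` of a CHARGED site, rebate `C` per charged site: the defect
  RIM is few-or-costly.  No scale window, no elastic constant, no rigidity in it; not cheaply implied by SEG or by CEG (probes P8, P12).

THE GLUE FROM THE SHAPE SLOT (§D, PROVED).  `TwoShellShape (1/100) ε g →` every charge-free UNFRAMED site has a charged site within `5/2·nn`
(`nearCharge_of_not_framed`): the `7/10`-separation hypothesis of `TwoShellShape` is a normalisation, discharged by RESCALING the configuration
(`nearestDist_smul`, `isChargeFree_smul_iff`; charge, bonds and frames are scale-invariant).  Hence a charge-free site that is not deeply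
registered is near charge at radius `7ρ/2 + 5/2` (`nearCharge_of_not_deepReg`).  THE SEAM (§E): with `λ = c₂ / (2 (C₁⁺ + c₂))` the combination
`λ·(α) + (1−λ)·(β′)` prices every scale-bad site at `λ·min(c₁,c₂)`: a deeply registered one by (α); any other one is charge-free and near charge,
priced `(1−λ) c₂ ≥ λ (C₁⁺ + c₂)` by (β′) — which also absorbs the rebate `λ C₁⁺` that (α) grants each unframed charge-free site.

WHY THE SPLIT IS A REDUCTION.  SEG mixes two mechanisms with different currencies: (i) ELASTIC — registered matter off the window scale is
uniformly strained against its own two-shell frame and pays quadratically (Cauchy–Born energy; geometric rigidity aggregates it); (ii) DEFECT RIM —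
near a charged site nothing is framed and no elastic statement applies, but rim sites are controlled by the charged sites they surround.  RSG is
(i) alone with every rim site REBATED; NCG is (ii) alone with no scale window in it.  Neither alone gives SEG (probes P1, P2), nor RDEF together
with the shape slot (P11); SEG gives RSG (§C) but not, cheaply, NCG (P8).

CONE XLI (§F, by name): `rdef_of_ceg_shape_registered_nearCharge_gap` (general `ρ ε g`) and the record instance
`rdef_of_ceg_shape_registered_nearCharge_gapFree : ChargedEnergyGap → TwoShellShape (1/100) (3/50) (1/450) → RegisteredScaleGap (122/125) 0 4
(3/50) (1/450) → NearChargeGap (33/2) → GapFreeShells → CleanlessExcessT → CoherentResidual 10 → RobustDefectLimitWindows`.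
Reference-free; nothing at margin 2; axioms `propext`, `Classical.choice`, `Quot.sound` only.
-/

namespace Summit.AtomisticToContinuum.Crystallization.Theorems.OverbindingBudgetMisfitRegistration

open Literature.MathematicalPhysics.StatisticalMechanics
open Literature.Geometry.DiscreteGeometry (IsChargeFree bondGraph nearestDist nearestDist_le_dist nearestDist_nonneg nearestDist_smul
  isChargeFree_smul_iff fccTwoShellPattern hcpTwoShellPattern)
open Summit.AtomisticToContinuum.Crystallization.Theses.OverbindingBudget (RobustDefectLimitWindows)
open Summit.AtomisticToContinuum.Crystallization.Theses.PricedLinkCensus (ChargedEnergyGap)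
open Summit.AtomisticToContinuum.Crystallization.Theorems.OverbindingBudgetGradedBareness (CleanlessExcessT)
open Summit.AtomisticToContinuum.Crystallization.Theorems.OverbindingBudgetCoherentCut (CoherentResidual)
open Summit.AtomisticToContinuum.Crystallization.Theorems.OverbindingBudgetViolatorDensityFloor (RT)
open Summit.AtomisticToContinuum.Crystallization.Theorems.OverbindingBudgetElasticSplitStatements (chargedCount)
open Summit.AtomisticToContinuum.Crystallization.Theorems.OverbindingBudgetMisfitCensusStatements (Bad Short Long Gap scaleCount
  ScaleEnergyGap GapEnergyGap GapFreeShells)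
open Summit.AtomisticToContinuum.Crystallization.Theorems.OverbindingBudgetMisfitCensus (rdef_of_ceg_scale_gap rdef_of_ceg_scale_gapFree)
open Summit.AtomisticToContinuum.Crystallization.Theorems.OverbindingBudgetTwoShellShape (TwoShellShape)

variable {N : ℕ}

/-! ## §A  Registration predicates (potential-free, scale-free, local) -/

/-- `Framed ε g y i`: VERBATIM the conclusion of `TwoShellShape θ ε g` at the site `i` — some linear isometric image of the fcc or the hcp
two-shell pattern, scaled by `nearestDist y i` and centred at `y i`, is matched injectively by sites within `ε·nearestDist y i`, and every site
`≠ y i` within `(3/2 + g)·nearestDist y i` is matched. -/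
def Framed (ε g : ℝ) (y : Fin N → EuclideanSpace ℝ (Fin 3)) (i : Fin N) : Prop :=
  ∃ (A : EuclideanSpace ℝ (Fin 3) →ₗᵢ[ℝ] EuclideanSpace ℝ (Fin 3)) (P : Finset (EuclideanSpace ℝ (Fin 3)))
    (f : EuclideanSpace ℝ (Fin 3) → EuclideanSpace ℝ (Fin 3)),
    (P = fccTwoShellPattern ∨ P = hcpTwoShellPattern) ∧
    (∀ v ∈ P, f v ∈ Set.range y ∧ dist (f v) (y i + nearestDist y i • A v) ≤ ε * nearestDist y i) ∧ Set.InjOn f ↑P ∧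
    ∀ k : Fin N, k ≠ i → dist (y k) (y i) ≤ (3 / 2 + g) * nearestDist y i → ∃ v ∈ P, f v = y k

/-- `Reg ε g y i` («registered»): `i` is `(1/100)`-charge-free AND two-shell framed. -/
def Reg (ε g : ℝ) (y : Fin N → EuclideanSpace ℝ (Fin 3)) (i : Fin N) : Prop :=
  IsChargeFree (1 / 100 : ℝ) y i ∧ Framed ε g y i

/-- `DeepReg ρ ε g y i`: every site within `ρ·nearestDist y i` of `y i` (including `i`) is registered. -/
def DeepReg (ρ ε g : ℝ) (y : Fin N → EuclideanSpace ℝ (Fin 3)) (i : Fin N) : Prop :=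
  ∀ i' : Fin N, dist (y i') (y i) ≤ ρ * nearestDist y i → Reg ε g y i'

/-- `NearCharge ρ y i`: some `(1/100)`-CHARGED site lies within `ρ·nearestDist y i` of `y i`. -/
def NearCharge (ρ : ℝ) (y : Fin N → EuclideanSpace ℝ (Fin 3)) (i : Fin N) : Prop :=
  ∃ i' : Fin N, ¬ IsChargeFree (1 / 100 : ℝ) y i' ∧ dist (y i') (y i) ≤ ρ * nearestDist y i

/-- Number of scale-bad (SHORT/LONG) sites that are deeply registered. -/
noncomputable def regScaleCount (a s ρ ε g : ℝ) (y : Fin N → EuclideanSpace ℝ (Fin 3)) : ℕ :=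
  Nat.card {i : Fin N // (Bad a s y i ∧ (Short a s y i ∨ Long a s y i)) ∧ DeepReg ρ ε g y i}

/-- Number of unregistered sites (charged, or charge-free but not two-shell framed). -/
noncomputable def unregCount (ε g : ℝ) (y : Fin N → EuclideanSpace ℝ (Fin 3)) : ℕ :=
  Nat.card {i : Fin N // ¬ Reg ε g y i}

/-- Number of charge-free sites near a charged site. -/
noncomputable def nearChargeCount (ρ : ℝ) (y : Fin N → EuclideanSpace ℝ (Fin 3)) : ℕ :=
  Nat.card {i : Fin N // IsChargeFree (1 / 100 : ℝ) y i ∧ NearCharge ρ y i}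

/-! ## §B  The two pieces -/

/-- **`RegisteredScaleGap a s ρ ε g` («RSG», piece (α))** — the aggregate Cauchy–Born coercivity of REGISTERED matter: uniformly in `N`, an
injective configuration pays `c > 0` per scale-bad site all of whose sites within `ρ·nn` are charge-free and two-shell framed, above `N e⋆`,
up to a rebate `C` per UNREGISTERED site and the surface term.  KERNEL-WEAKER than SEG (prices a subset, rebates a superset). -/
def RegisteredScaleGap (a s ρ ε g : ℝ) : Prop :=
  ∃ c C : ℝ, 0 < c ∧ ∀ (N : ℕ) (y : Fin N → EuclideanSpace ℝ (Fin 3)), Function.Injective y →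
    (N : ℝ) * (⨅ Q : PeriodicConfiguration 3, Q.energyPerParticle lennardJones) + c * (regScaleCount a s ρ ε g y : ℝ)
      - C * (unregCount ε g y : ℝ) - C * (N : ℝ) ^ (2 / 3 : ℝ) ≤ interactionEnergy lennardJones y

/-- **`NearChargeGap ρ` («NCG», piece (β′))** — charge-free sites NEAR a charged site are few or costly: `c > 0` per charge-free site having
a charged site within `ρ·nn`, above `N e⋆`, up to `C` per charged site and the surface term.  Potential-side bookkeeping of the defect RIM; no
elastic constant and no shape rigidity enters. -/
def NearChargeGap (ρ : ℝ) : Prop :=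
  ∃ c C : ℝ, 0 < c ∧ ∀ (N : ℕ) (y : Fin N → EuclideanSpace ℝ (Fin 3)), Function.Injective y →
    (N : ℝ) * (⨅ Q : PeriodicConfiguration 3, Q.energyPerParticle lennardJones) + c * (nearChargeCount ρ y : ℝ)
      - C * (chargedCount y : ℝ) - C * (N : ℝ) ^ (2 / 3 : ℝ) ≤ interactionEnergy lennardJones y

/-! ## §C  Kernel arrow: SEG ⇒ RSG (PROVED) -/

/-- A charged site is unregistered; hence `#charged ≤ #unregistered`. -/
theorem chargedCount_le_unregCount (ε g : ℝ) (y : Fin N → EuclideanSpace ℝ (Fin 3)) : chargedCount y ≤ unregCount ε g y := by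
  classical
  unfold chargedCount unregCount
  exact Nat.card_le_card_of_injective (fun i => ⟨i.1, fun h => i.2 h.1⟩)
    (fun a b hab => Subtype.ext (by simpa using congrArg Subtype.val hab))

/-- `#registered-scale-bad ≤ #scale-bad`. -/
theorem regScaleCount_le_scaleCount (a s ρ ε g : ℝ) (y : Fin N → EuclideanSpace ℝ (Fin 3)) :
    regScaleCount a s ρ ε g y ≤ scaleCount a s y := by
  classical
  unfold regScaleCount scaleCount
  exact Nat.card_le_card_of_injective (fun i => ⟨i.1, i.2.1⟩) (fun a b hab => Subtype.ext (by simpa using congrArg Subtype.val hab))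

/-- **SEG ⇒ RSG** (any `ρ ε g`). [this file] -/
theorem registeredScaleGap_of_scaleEnergyGap {a s : ℝ} (ρ ε g : ℝ) (h : ScaleEnergyGap a s) : RegisteredScaleGap a s ρ ε g := by
  obtain ⟨c, C, hc, hS⟩ := h
  refine ⟨c, max C 0, hc, fun N y hy => ?_⟩
  have e := hS N y hy
  have h1 : (regScaleCount a s ρ ε g y : ℝ) ≤ scaleCount a s y := by exact_mod_cast regScaleCount_le_scaleCount a s ρ ε g y
  have h2 : (chargedCount y : ℝ) ≤ unregCount ε g y := by exact_mod_cast chargedCount_le_unregCount ε g y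
  have hC0 : 0 ≤ max C 0 := le_max_right _ _
  have hCle : C ≤ max C 0 := le_max_left _ _
  have hm0 : (0 : ℝ) ≤ chargedCount y := Nat.cast_nonneg _
  have hN23 : (0 : ℝ) ≤ (N : ℝ) ^ (2 / 3 : ℝ) := Real.rpow_nonneg (Nat.cast_nonneg _) _
  nlinarith [mul_nonneg hC0 (sub_nonneg.2 h2), mul_nonneg (sub_nonneg.2 hCle) hm0, mul_nonneg (sub_nonneg.2 hCle) hN23,
    mul_le_mul_of_nonneg_left h1 hc.le]

/-! ## §D  The glue from `TwoShellShape`: unframed charge-free sites are near charge (PROVED, by rescaling to `7/10`-separation) -/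

/-- A finite injective configuration has a positive separation. -/
theorem exists_sep (y : Fin N → EuclideanSpace ℝ (Fin 3)) (hy : Function.Injective y) :
    ∃ m : ℝ, 0 < m ∧ ∀ a b : Fin N, a ≠ b → m ≤ dist (y a) (y b) := by
  classical
  by_cases hne : Nonempty {p : Fin N × Fin N // p.1 ≠ p.2}
  · obtain ⟨p₀, hp₀⟩ := Finite.exists_min (fun p : {p : Fin N × Fin N // p.1 ≠ p.2} => dist (y p.1.1) (y p.1.2))
    exact ⟨dist (y p₀.1.1) (y p₀.1.2), dist_pos.2 (fun h => p₀.2 (hy h)), fun a b hab => hp₀ ⟨(a, b), hab⟩⟩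
  · exact ⟨1, one_pos, fun a b hab => absurd ⟨⟨(a, b), hab⟩⟩ hne⟩

/-- **Rescaling + `TwoShellShape`: an unframed site has a charged site within `5/2·nn`.**  (The `7/10`-separation hypothesis of `TwoShellShape`
is a normalisation: charge, bonds and the framing are scale-invariant.) [this file] -/
theorem nearCharge_of_not_framed {ε g : ℝ} (hT : TwoShellShape (1 / 100) ε g) {y : Fin N → EuclideanSpace ℝ (Fin 3)}
    (hy : Function.Injective y) {i : Fin N} (h : ¬ Framed ε g y i) : NearCharge (5 / 2) y i := by
  by_contra hnc
  have hcf : ∀ i' : Fin N, dist (y i') (y i) ≤ 5 / 2 * nearestDist y i → IsChargeFree (1 / 100 : ℝ) y i' := by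
    intro i' hd
    by_contra hc
    exact hnc ⟨i', hc, hd⟩
  obtain ⟨m, hm, hsep⟩ := exists_sep y hy
  set t : ℝ := 7 / 10 / m with ht
  have ht0 : 0 < t := by positivity
  have htne : t ≠ 0 := ht0.ne'
  have hdist : ∀ p q : EuclideanSpace ℝ (Fin 3), dist (t • p) (t • q) = t * dist p q := fun p q => by
    rw [dist_smul₀, Real.norm_of_nonneg ht0.le]
  have hnn : ∀ j : Fin N, nearestDist (t • y) j = t * nearestDist y j := fun j => by
    rw [nearestDist_smul, Real.norm_of_nonneg ht0.le]
  have hinj' : Function.Injective (t • y) := fun a b hab => hy (smul_right_injective (EuclideanSpace ℝ (Fin 3)) htne hab)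
  have hsep' : ∀ a b : Fin N, a ≠ b → (7 : ℝ) / 10 ≤ dist ((t • y) a) ((t • y) b) := by
    intro a b hab
    rw [Pi.smul_apply, Pi.smul_apply, hdist]
    calc (7 : ℝ) / 10 = t * m := by rw [ht]; field_simp
      _ ≤ t * dist (y a) (y b) := mul_le_mul_of_nonneg_left (hsep a b hab) ht0.le
  have hcf' : ∀ i' : Fin N, dist ((t • y) i') ((t • y) i) ≤ 5 / 2 * nearestDist (t • y) i →
      IsChargeFree (1 / 100 : ℝ) (t • y) i' := by
    intro i' hd
    rw [isChargeFree_smul_iff htne]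
    apply hcf
    rw [hnn, Pi.smul_apply, Pi.smul_apply, hdist] at hd
    have : t * dist (y i') (y i) ≤ t * (5 / 2 * nearestDist y i) := by linarith
    exact le_of_mul_le_mul_left this ht0
  obtain ⟨A, P, f, hP, hmatch, hinjOn, hcov⟩ := hT N (t • y) i hinj' hsep' hcf'
  apply h
  refine ⟨A, P, fun v => t⁻¹ • f v, hP, fun v hv => ?_, ?_, fun k hk hd => ?_⟩
  · obtain ⟨⟨j, hj⟩, hdv⟩ := hmatch v hv
    refine ⟨⟨j, ?_⟩, ?_⟩
    · show y j = t⁻¹ • f v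
      rw [← hj, Pi.smul_apply, smul_smul, inv_mul_cancel₀ htne, one_smul]
    · show dist (t⁻¹ • f v) (y i + nearestDist y i • A v) ≤ ε * nearestDist y i
      have hX : (t • y) i + nearestDist (t • y) i • A v = t • (y i + nearestDist y i • A v) := by
        rw [hnn, Pi.smul_apply, smul_add, smul_smul]
      have hY : y i + nearestDist y i • A v = t⁻¹ • (t • (y i + nearestDist y i • A v)) := by
        rw [smul_smul, inv_mul_cancel₀ htne, one_smul]
      rw [hY, dist_smul₀, norm_inv, Real.norm_of_nonneg ht0.le, ← hX]
      calc t⁻¹ * dist (f v) ((t • y) i + nearestDist (t • y) i • A v) ≤ t⁻¹ * (ε * nearestDist (t • y) i) :=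
            mul_le_mul_of_nonneg_left hdv (inv_nonneg.2 ht0.le)
        _ = ε * nearestDist y i := by rw [hnn]; field_simp
  · intro v hv w hw hvw
    exact hinjOn hv hw (smul_right_injective (EuclideanSpace ℝ (Fin 3)) (inv_ne_zero htne) hvw)
  · have hd' : dist ((t • y) k) ((t • y) i) ≤ (3 / 2 + g) * nearestDist (t • y) i := by
      rw [hnn, Pi.smul_apply, Pi.smul_apply, hdist]
      have := mul_le_mul_of_nonneg_left hd ht0.le
      linarith
    obtain ⟨v, hv, hfv⟩ := hcov k hk hd'
    exact ⟨v, hv, by simp only [hfv, Pi.smul_apply, smul_smul, inv_mul_cancel₀ htne, one_smul]⟩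

/-- Near-charge is monotone in the radius. -/
theorem NearCharge.mono {ρ ρ' : ℝ} (hρ : ρ ≤ ρ') {y : Fin N → EuclideanSpace ℝ (Fin 3)} {i : Fin N} (h : NearCharge ρ y i) :
    NearCharge ρ' y i := by
  obtain ⟨i', hc, hd⟩ := h
  exact ⟨i', hc, hd.trans (mul_le_mul_of_nonneg_right hρ (nearestDist_nonneg y i))⟩

/-- **A charge-free site that is NOT deeply registered is near charge** (radius `7ρ/2 + 5/2`, `ρ ≥ 0`): the unregistered site `i'` within
`ρ·nn_i` is charged, or charge-free and unframed hence (by `nearCharge_of_not_framed`) within `5/2·nn_{i'} ≤ 5ρ/2·nn_i` of a charged site. -/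
theorem nearCharge_of_not_deepReg {ρ ε g : ℝ} (hρ : 0 ≤ ρ) (hT : TwoShellShape (1 / 100) ε g)
    {y : Fin N → EuclideanSpace ℝ (Fin 3)} (hy : Function.Injective y) {i : Fin N} (h : ¬ DeepReg ρ ε g y i) :
    NearCharge (7 * ρ / 2 + 5 / 2) y i := by
  unfold DeepReg at h
  push Not at h
  obtain ⟨i', hd, hnr⟩ := h
  have hnn0 : 0 ≤ nearestDist y i := nearestDist_nonneg y i
  by_cases hc : IsChargeFree (1 / 100 : ℝ) y i'
  · -- `i'` is charge-free but unframed
    have hnf : ¬ Framed ε g y i' := fun hf => hnr ⟨hc, hf⟩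
    obtain ⟨i'', hc'', hd''⟩ := nearCharge_of_not_framed hT hy hnf
    refine ⟨i'', hc'', ?_⟩
    -- `nn_{i'} ≤ dist (y i') (y i) ≤ ρ nn_i` if `i' ≠ i`; if `i' = i` directly
    by_cases hii : i' = i
    · subst hii
      calc dist (y i'') (y i') ≤ 5 / 2 * nearestDist y i' := hd''
        _ ≤ (7 * ρ / 2 + 5 / 2) * nearestDist y i' := by nlinarith
    · have hnn' : nearestDist y i' ≤ ρ * nearestDist y i := (nearestDist_le_dist y (Ne.symm hii)).trans hd
      calc dist (y i'') (y i) ≤ dist (y i'') (y i') + dist (y i') (y i) := dist_triangle _ _ _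
        _ ≤ 5 / 2 * nearestDist y i' + ρ * nearestDist y i := add_le_add hd'' hd
        _ ≤ 5 / 2 * (ρ * nearestDist y i) + ρ * nearestDist y i := by nlinarith
        _ = (7 * ρ / 2 + 5 / 2) * nearestDist y i - 5 / 2 * nearestDist y i := by ring
        _ ≤ (7 * ρ / 2 + 5 / 2) * nearestDist y i := by linarith
  · exact ⟨i', hc, hd.trans (mul_le_mul_of_nonneg_right (by linarith) hnn0)⟩

/-! ## §E  The seam: SEG from the three pieces (PROVED) -/

/-- `#unregistered ≤ #charged + #(charge-free ∧ near charge at radius ≥ 5/2)`. -/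
theorem unregCount_le {ρ' ε g : ℝ} (hρ' : 5 / 2 ≤ ρ') (hT : TwoShellShape (1 / 100) ε g) {y : Fin N → EuclideanSpace ℝ (Fin 3)}
    (hy : Function.Injective y) : unregCount ε g y ≤ chargedCount y + nearChargeCount ρ' y := by
  classical
  simp only [unregCount, chargedCount, nearChargeCount, Nat.card_eq_fintype_card, Fintype.card_subtype]
  calc (Finset.univ.filter fun i => ¬ Reg ε g y i).card
      ≤ ((Finset.univ.filter fun i => ¬ IsChargeFree (1 / 100 : ℝ) y i) ∪
          (Finset.univ.filter fun i => IsChargeFree (1 / 100 : ℝ) y i ∧ NearCharge ρ' y i)).card := by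
        apply Finset.card_le_card
        intro i hi
        rw [Finset.mem_filter] at hi
        rw [Finset.mem_union, Finset.mem_filter, Finset.mem_filter]
        by_cases hc : IsChargeFree (1 / 100 : ℝ) y i
        · have hnf : ¬ Framed ε g y i := fun hf => hi.2 ⟨hc, hf⟩
          exact Or.inr ⟨hi.1, hc, (nearCharge_of_not_framed hT hy hnf).mono hρ'⟩
        · exact Or.inl ⟨hi.1, hc⟩
    _ ≤ _ := Finset.card_union_le _ _

/-- `#scale-bad ≤ #registered-scale-bad + #(charge-free ∧ near charge at radius 7ρ/2 + 5/2)`. -/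
theorem scaleCount_le {a s ρ ε g : ℝ} (hρ : 0 ≤ ρ) (hT : TwoShellShape (1 / 100) ε g) {y : Fin N → EuclideanSpace ℝ (Fin 3)}
    (hy : Function.Injective y) : scaleCount a s y ≤ regScaleCount a s ρ ε g y + nearChargeCount (7 * ρ / 2 + 5 / 2) y := by
  classical
  simp only [scaleCount, regScaleCount, nearChargeCount, Nat.card_eq_fintype_card, Fintype.card_subtype]
  calc (Finset.univ.filter fun i => Bad a s y i ∧ (Short a s y i ∨ Long a s y i)).card
      ≤ ((Finset.univ.filter fun i => (Bad a s y i ∧ (Short a s y i ∨ Long a s y i)) ∧ DeepReg ρ ε g y i) ∪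
          (Finset.univ.filter fun i => IsChargeFree (1 / 100 : ℝ) y i ∧ NearCharge (7 * ρ / 2 + 5 / 2) y i)).card := by
        apply Finset.card_le_card
        intro i hi
        rw [Finset.mem_filter] at hi
        rw [Finset.mem_union, Finset.mem_filter, Finset.mem_filter]
        by_cases hD : DeepReg ρ ε g y i
        · exact Or.inl ⟨hi.1, hi.2, hD⟩
        · exact Or.inr ⟨hi.1, hi.2.1.1, nearCharge_of_not_deepReg hρ hT hy hD⟩
    _ ≤ _ := Finset.card_union_le _ _
set_option maxHeartbeats 400000 in
/-- **THE SEAM.  `TwoShellShape (1/100) ε g → RegisteredScaleGap a s ρ ε g → NearChargeGap (7ρ/2 + 5/2) → ScaleEnergyGap a s`** (`ρ ≥ 0`):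
the `λ`-combination `λ·(α) + (1−λ)·(β′)` with `λ = c₂ / (2 (C₁ + c₂))`, so that the rebate `λ C₁` per unframed charge-free site is dominated
by the price `(1−λ) c₂` the near-charge census charges for it. [this file] -/
theorem scaleEnergyGap_of_registered_nearCharge {a s ρ ε g : ℝ} (hρ : 0 ≤ ρ) (hT : TwoShellShape (1 / 100) ε g)
    (hR : RegisteredScaleGap a s ρ ε g) (hNC : NearChargeGap (7 * ρ / 2 + 5 / 2)) : ScaleEnergyGap a s := by
  obtain ⟨c₁, C₁, hc₁, h₁⟩ := hR
  obtain ⟨c₂, C₂, hc₂, h₂⟩ := hNC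
  -- normalise the rebates to be nonnegative
  set D₁ : ℝ := max C₁ 0 with hD₁
  set D₂ : ℝ := max C₂ 0 with hD₂
  have hD₁0 : 0 ≤ D₁ := le_max_right _ _
  have hD₂0 : 0 ≤ D₂ := le_max_right _ _
  have hC₁le : C₁ ≤ D₁ := le_max_left _ _
  have hC₂le : C₂ ≤ D₂ := le_max_left _ _
  -- the weight
  set l : ℝ := c₂ / (2 * (D₁ + c₂)) with hl
  have hden : 0 < 2 * (D₁ + c₂) := by positivity
  have hl0 : 0 < l := by positivity
  have hldef : l * (2 * (D₁ + c₂)) = c₂ := by rw [hl]; field_simp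
  have hl1 : l ≤ 1 / 2 := by
    rw [hl, div_le_iff₀ hden]; nlinarith
  refine ⟨l * min c₁ c₂, D₁ + D₂, by positivity, fun N y hy => ?_⟩
  have e₁ := h₁ N y hy
  have e₂ := h₂ N y hy
  -- counts
  have hU : (unregCount ε g y : ℝ) ≤ chargedCount y + nearChargeCount (7 * ρ / 2 + 5 / 2) y := by
    exact_mod_cast unregCount_le (by linarith) hT hy
  have hS : (scaleCount a s y : ℝ) ≤ regScaleCount a s ρ ε g y + nearChargeCount (7 * ρ / 2 + 5 / 2) y := by
    exact_mod_cast scaleCount_le hρ hT hy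
  have hA0 : (0 : ℝ) ≤ regScaleCount a s ρ ε g y := Nat.cast_nonneg _
  have hB0 : (0 : ℝ) ≤ nearChargeCount (7 * ρ / 2 + 5 / 2) y := Nat.cast_nonneg _
  have hU0 : (0 : ℝ) ≤ unregCount ε g y := Nat.cast_nonneg _
  have hm0 : (0 : ℝ) ≤ chargedCount y := Nat.cast_nonneg _
  have hsc0 : (0 : ℝ) ≤ scaleCount a s y := Nat.cast_nonneg _
  have hN23 : (0 : ℝ) ≤ (N : ℝ) ^ (2 / 3 : ℝ) := Real.rpow_nonneg (Nat.cast_nonneg _) _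
  -- (α) and (β′) with nonnegative rebates
  have e₁' : (N : ℝ) * (⨅ Q : PeriodicConfiguration 3, Q.energyPerParticle lennardJones) + c₁ * (regScaleCount a s ρ ε g y : ℝ)
      - D₁ * (unregCount ε g y : ℝ) - D₁ * (N : ℝ) ^ (2 / 3 : ℝ) ≤ interactionEnergy lennardJones y := by
    nlinarith [mul_nonneg (sub_nonneg.2 hC₁le) hU0, mul_nonneg (sub_nonneg.2 hC₁le) hN23]
  have e₂' : (N : ℝ) * (⨅ Q : PeriodicConfiguration 3, Q.energyPerParticle lennardJones)
      + c₂ * (nearChargeCount (7 * ρ / 2 + 5 / 2) y : ℝ) - D₂ * (chargedCount y : ℝ) - D₂ * (N : ℝ) ^ (2 / 3 : ℝ) ≤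
      interactionEnergy lennardJones y := by
    nlinarith [mul_nonneg (sub_nonneg.2 hC₂le) hm0, mul_nonneg (sub_nonneg.2 hC₂le) hN23]
  -- the λ-combination
  have f₁ := mul_le_mul_of_nonneg_left e₁' hl0.le
  have f₂ := mul_le_mul_of_nonneg_left e₂' (by linarith : (0 : ℝ) ≤ 1 - l)
  -- price bookkeeping: (1 - l) c₂ - l D₁ ≥ l c₂
  have hkey : l * c₂ ≤ (1 - l) * c₂ - l * D₁ := by nlinarith
  have hmin₁ : l * min c₁ c₂ ≤ l * c₁ := mul_le_mul_of_nonneg_left (min_le_left _ _) hl0.le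
  have hmin₂ : l * min c₁ c₂ ≤ l * c₂ := mul_le_mul_of_nonneg_left (min_le_right _ _) hl0.le
  have hmin0 : 0 ≤ l * min c₁ c₂ := by positivity
  nlinarith [mul_le_mul_of_nonneg_left hS hmin0, mul_le_mul_of_nonneg_left hU (mul_nonneg hl0.le hD₁0),
    mul_nonneg hA0 (sub_nonneg.2 hmin₁), mul_nonneg hB0 (sub_nonneg.2 hmin₂), mul_nonneg hB0 (sub_nonneg.2 hkey),
    mul_nonneg hm0 hD₁0, mul_nonneg hm0 hD₂0, mul_nonneg hN23 hD₁0, mul_nonneg hN23 hD₂0,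
    mul_nonneg (mul_nonneg hl0.le hD₂0) hm0, mul_nonneg (mul_nonneg hl0.le hD₂0) hN23,
    mul_nonneg (mul_nonneg (by linarith : (0:ℝ) ≤ 1 - l) hD₁0) hm0, mul_nonneg (mul_nonneg (by linarith : (0:ℝ) ≤ 1 - l) hD₁0) hN23]

/-! ## §F  Cone XLI through the registration split (by name) -/

/-- `ChargedEnergyGap → TwoShellShape (1/100) ε g → RegisteredScaleGap (122/125) 0 ρ ε g → NearChargeGap (7ρ/2 + 5/2) → GapEnergyGap (122/125) 0
→ CleanlessExcessT → CoherentResidual 10 → RobustDefectLimitWindows` (`ρ ≥ 0`). [this file] -/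
theorem rdef_of_ceg_shape_registered_nearCharge_gap {ρ ε g : ℝ} (hρ : 0 ≤ ρ) (hCEG : ChargedEnergyGap)
    (hT : TwoShellShape (1 / 100) ε g) (hR : RegisteredScaleGap (122 / 125) 0 ρ ε g) (hNC : NearChargeGap (7 * ρ / 2 + 5 / 2))
    (hG : GapEnergyGap (122 / 125) 0) (hCE : CleanlessExcessT) (hRes : CoherentResidual 10) : RobustDefectLimitWindows :=
  rdef_of_ceg_scale_gap hCEG (scaleEnergyGap_of_registered_nearCharge hρ hT hR hNC) hG hCE hRes

/-- The record instance (`ρ = 4`, the lineage's shape literals `ε = 3/50`, `g = 1/450`; near-charge radius `33/2`), with the geometric second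
piece: `ChargedEnergyGap → TwoShellShape (1/100) (3/50) (1/450) → RegisteredScaleGap (122/125) 0 4 (3/50) (1/450) → NearChargeGap (33/2) →
GapFreeShells → CleanlessExcessT → CoherentResidual 10 → RobustDefectLimitWindows`. [this file] -/
theorem rdef_of_ceg_shape_registered_nearCharge_gapFree (hCEG : ChargedEnergyGap) (hT : TwoShellShape (1 / 100) (3 / 50) (1 / 450))
    (hR : RegisteredScaleGap (122 / 125) 0 4 (3 / 50) (1 / 450)) (hNC : NearChargeGap (33 / 2)) (hGF : GapFreeShells)
    (hCE : CleanlessExcessT) (hRes : CoherentResidual 10) : RobustDefectLimitWindows :=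
  rdef_of_ceg_scale_gapFree hCEG
    (scaleEnergyGap_of_registered_nearCharge (ρ := 4) (by norm_num) hT hR
      (by rw [show (7 : ℝ) * 4 / 2 + 5 / 2 = 33 / 2 by norm_num]; exact hNC))
    hGF hCE hRes

end Summit.AtomisticToContinuum.Crystallization.Theorems.OverbindingBudgetMisfitRegistration
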